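import Summits.AtomisticToContinuum.HydrodynamicLimit.Theorems.CollisionIsometryCLTAdaptedWeightCLTCBPathwiseBudget
import Summits.AtomisticToContinuum.HydrodynamicLimit.Theorems.CollisionIsometryCLTAdaptedWeightCLTCBTimeZero
import Summits.AtomisticToContinuum.HydrodynamicLimit.Theorems.CollisionIsometryCLTAdaptedWeightCLTCBTailsVmax
import Summits.AtomisticToContinuum.HydrodynamicLimit.Theorems.CollisionIsometryCLTAdaptedWeightCLTCBLipschitz

/-!
# Skeleton v3 of the line `Sketch` (contact-balance composition) for the crux `AdaptedWeightCLT`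
(stmt-AtomisticToContinuum-14868, rev-12 TIME-LOCAL form; route `CollisionIsometryCLT`, sub-problem
`HydrodynamicLimit`; lead `prover-line-stmt-AtomisticToContinuum-14868-c3-0`, continuing leads c1/c2)

v3 = v2 with ALL SIX landed stubs IMPORTED instead of restated:
`Theorems/CollisionIsometryCLTAdaptedWeightCLTContactBalance.lean` (vocabulary), `…CBPointwise.lean` (`stub_pointwise`, c1),
`…CBLipschitz.lean` (`stub_lipschitz`, c1), `…CBFreeStretch.lean` (`stub_freeStretch`, c1), `…CBPathwiseBudget.lean`
(`stub_pathwiseBudget`, p128254), `…CBTimeZero.lean` (`stub_timeZero`, p127913), `…CBTailsVmax.lean` (`stub_tailsVmax`,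
p127687). ONE OPEN stub (sorried below, registered signature unchanged): `stub_coercivity`.

MECHANISM (card `Ideas/contact-balance-knudsen-margin.md`). Do the bookkeeping EULERIAN, along the flow, for the
crux's own functional: the block kinetic anisotropy `anis(w) = ∫ₓ Σ_{jk} D_{jk}(w,x)² + |q(w,x)|² dx` of a
configuration `w` (the crux integrand is `DefectSq` by the landed dictionary `Reduction.cruxIntegrand_eq`, and
`DefectSq σ N Φ φ s z x = defectC N φ (Φ.flow s z) x` by `rfl`). Along a good orbit `s ↦ Φ_s z` the function
`s ↦ anis(Φ_s z)` moves by FREE-FLIGHT STREAMING between collisions and JUMPS at the (finitely many) collision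
times. The total collisional anisotropy drop on `(0, t]`,
`prodColl = Σ_{collisions} (anis(pre) − anis(post))` (the PRODUCTION), telescopes into
`anis(Φ_0 z) − anis(Φ_t z) + (total free-flight increment)`, and the free-flight increments are controlled by the
landed `L²ₓ`-Lipschitz estimate of the block fields along free flight (`stub_pointwise`, `stub_lipschitz`,
`stub_freeStretch`), giving the pathwise BUDGET `prodColl ≤ anis(Φ_0 z) + K (N+1)^γ (∫₀ᵗ (1+v_max)⁸)^{1/2} X^{1/2}`,
`X = ∫₀ᵗ anis` (= the crux functional; `stub_pathwiseBudget`). The time-zero term is `O_P((N+1)^p)` for every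
`p > 0` (`stub_timeZero`, statics of the local Gibbs law) and `∫₀ᵗ (1 + v_max)⁸ = O_P((N+1)^p)` for every `p > 0`
under H2 (`stub_tailsVmax`). The ONE residue is COERCIVITY of the production AT A POWER RATE (`stub_coercivity`):
`prodColl ≥ η (N+1)^β X − B` w.h.p. for some `β > γ`, `η > 0`, `B`. Then `κ X ≤ A + B √X ⇒ X ≤ 2A/κ + (B/κ)²`
(`knudsen_margin`) gives `X → 0` in probability, i.e. `ConclOn`, and the crux follows by the landed bookkeeping
`adaptedWeightCLT_iff` / `cruxTailT_of_conclOn` / `conclOn_of_tendsto_defect`.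

STATUS OF THE RESIDUE (leads c2/c3): modulo the six landed stubs `stub_coercivity` is the crux's conclusion WITH A
POWER RATE (certificate `ContactBalance.rate_of_coercivity`, proposal p128830), hence at least crux-sized, and its
`∀ t > 0` exposure makes it FALSE after shock formation (shock-layer production `O(1)` per unit time against
`X ≍ (N+1)^{−γ}` from the blocks straddling the shock forces `β ≤ γ`, see `Lines/Sketch.dead.md`).

The composition `AdaptedWeightCLT_of` is PROVED below (the only sorry is `stub_coercivity`).
-/

namespace Summit.AtomisticToContinuum.HydrodynamicLimit.Theorems.ContactBalance

open scoped BigOperators Topology Classical MeasureTheory ENNReal InnerProductSpace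
open Filter Set MeasureTheory
open Literature.Analysis.FluidPDE
open Summit.AtomisticToContinuum.HydrodynamicLimit.Theorems.ContactSourceDuhamel
open Summit.AtomisticToContinuum.HydrodynamicLimit.Theorems.ContactSourceDuhamel.TimeLocal
open Literature.MathematicalPhysics.KineticTheory (hsDiameter localGibbsLaw empiricalDensityField
  empiricalMomentumField localGibbsLaw_absolutelyContinuous)

noncomputable section

/-! ## The statements of the seven stubs as named propositions (for the composition) -/

/-- Statement of STUB 1 (pointwise free-flight increments). -/
def PointwiseStub : Prop := ∀ (γ C : ℝ) (φ : ℕ → T3 → ℝ), 0 < γ → γ ≤ 1 / 15 → AdmissibleKernel γ C φ →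
    PointwiseFreeFlight γ φ

/-- Statement of STUB 2 (pointwise ⇒ `L²ₓ`-Lipschitz). -/
def LipschitzStub : Prop := ∀ (γ C : ℝ) (φ : ℕ → T3 → ℝ), 0 < γ → γ ≤ 1 / 15 → AdmissibleKernel γ C φ →
    ∀ σ : ℝ, 0 < σ → σ < 2⁻¹ → PointwiseFreeFlight γ φ → FreeFlightLipschitz γ φ σ

/-- Statement of STUB 3 (Lipschitz ⇒ free-stretch bound). -/
def FreeStretchStub : Prop := ∀ (γ C : ℝ) (φ : ℕ → T3 → ℝ), 0 < γ → γ ≤ 1 / 15 → AdmissibleKernel γ C φ →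
    ∀ σ : ℝ, 0 < σ → σ < 2⁻¹ → FreeFlightLipschitz γ φ σ → FreeStretchBound γ φ σ

/-- Statement of STUB 4 (free-stretch bound ⇒ pathwise budget along good orbits). -/
def PathwiseBudgetStub : Prop := ∀ (γ C : ℝ) (φ : ℕ → T3 → ℝ), 0 < γ → γ ≤ 1 / 15 → AdmissibleKernel γ C φ →
    ∀ σ : ℝ, 0 < σ → σ < 2⁻¹ → FreeStretchBound γ φ σ →
      ∃ K : ℝ, ∃ N₀ : ℕ, ∀ N : ℕ, N₀ ≤ N → ∀ (Φ : Flow σ N) (t : ℝ), 0 ≤ t → ∀ z ∈ Φ.good,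
        prodColl σ N Φ φ t z ≤ anisC N φ (Φ.flow 0 z) +
          K * ((N + 1 : ℕ) : ℝ) ^ γ * Real.sqrt (vmaxInt σ N Φ t z) * Real.sqrt (Xint σ N Φ φ t z)

/-- Statement of STUB 5 (time zero). -/
def TimeZeroStub : Prop := ∀ (a₀ θ₀ : T3 → ℝ) (u₀ : T3 → V3), NiceProfiles a₀ θ₀ u₀ →
    ∀ σ : ℝ, 0 < σ → σ < 2⁻¹ → ∀ (γ C : ℝ) (φ : ℕ → T3 → ℝ), 0 < γ → γ ≤ 1 / 15 → AdmissibleKernel γ C φ →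
      ∀ (Φ : Flows σ) (p : ℝ), 0 < p →
        Tendsto (fun N : ℕ => localGibbsLaw σ a₀ u₀ θ₀ N (Φ N)
          {z | ((N + 1 : ℕ) : ℝ) ^ p < anisC N φ ((Φ N).flow 0 z)}) atTop (𝓝 0)

/-- Statement of STUB 6 (tails ⇒ integrated maximal speed). -/
def TailsVmaxStub : Prop := ∀ (a₀ θ₀ : T3 → ℝ) (u₀ : T3 → V3), NiceProfiles a₀ θ₀ u₀ →
    ∀ σ : ℝ, 0 < σ → σ < 2⁻¹ → ∀ (Φ : Flows σ) (t : ℝ), 0 < t → TailsOn σ a₀ θ₀ u₀ Φ t →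
      ∀ p : ℝ, 0 < p →
        Tendsto (fun N : ℕ => localGibbsLaw σ a₀ u₀ θ₀ N (Φ N)
          {z | ((N + 1 : ℕ) : ℝ) ^ p < vmaxInt σ N (Φ N) t z}) atTop (𝓝 0)

/-- Statement of STUB 7 (coercivity at a power rate). -/
def CoercivityStub : Prop := ∀ (a₀ θ₀ : T3 → ℝ) (u₀ : T3 → V3), NiceProfiles a₀ θ₀ u₀ →
    ∃ σ₀ : ℝ, 0 < σ₀ ∧ ∀ σ : ℝ, 0 < σ → σ < σ₀ → ∀ Φ : Flows σ, DiffuseAt σ a₀ θ₀ u₀ Φ →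
      ∀ (γ C : ℝ) (φ : ℕ → T3 → ℝ), 0 < γ → γ ≤ 1 / 15 → AdmissibleKernel γ C φ →
        ∀ t : ℝ, 0 < t → TailsOn σ a₀ θ₀ u₀ Φ t →
          ∃ β η B : ℝ, γ < β ∧ 0 < η ∧
            Tendsto (fun N : ℕ => localGibbsLaw σ a₀ u₀ θ₀ N (Φ N)
              {z | prodColl σ N (Φ N) φ t z <
                η * ((N + 1 : ℕ) : ℝ) ^ β * Xint σ N (Φ N) φ t z - B}) atTop (𝓝 0)

/-! ## The one open stub (`stub_pointwise`, `stub_lipschitz`, `stub_freeStretch`, `stub_pathwiseBudget`, `stub_timeZero`,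
`stub_tailsVmax` are imported) -/

/-- STUB 7 (COERCIVITY OF THE COLLISIONAL PRODUCTION AT A POWER RATE — the residue of the line). For all
nice profiles there is `σ₀ > 0` such that for `0 < σ < σ₀`, every flow family with diffuse backward influence
(H1), every admissible kernel family and every `t > 0` with the H2 tail bound on `[0,t]`, there are `β > γ`,
`η > 0` and `B` with `P_N{prodColl < η (N+1)^β X − B} → 0`: the total collisional anisotropy drop on `(0,t]`
dominates `(N+1)^β` times the time-integrated block anisotropy, up to `O(1)`. (Chaos heuristic: rate
`c₀ ν_N = c₀ σ² (N+1)^{1/3}`, `c₀ ≈ 0.9` for the hard-sphere kernel; modulo STUBS 1–6 the statement is equivalent to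
"`X = O_P((N+1)^{γ−β'})` for some `β' > γ`"; the two failure modes are production-degenerate normal geometries —
the `ipr ≥ 1` kernels excised by H1 — and colliding partners carrying the block's traceless covariance coherently
(sub-block shear).) -/
theorem stub_coercivity : ∀ (a₀ θ₀ : T3 → ℝ) (u₀ : T3 → V3), NiceProfiles a₀ θ₀ u₀ →
    ∃ σ₀ : ℝ, 0 < σ₀ ∧ ∀ σ : ℝ, 0 < σ → σ < σ₀ → ∀ Φ : Flows σ, DiffuseAt σ a₀ θ₀ u₀ Φ →
      ∀ (γ C : ℝ) (φ : ℕ → T3 → ℝ), 0 < γ → γ ≤ 1 / 15 → AdmissibleKernel γ C φ →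
        ∀ t : ℝ, 0 < t → TailsOn σ a₀ θ₀ u₀ Φ t →
          ∃ β η B : ℝ, γ < β ∧ 0 < η ∧
            Tendsto (fun N : ℕ => localGibbsLaw σ a₀ u₀ θ₀ N (Φ N)
              {z | prodColl σ N (Φ N) φ t z <
                η * ((N + 1 : ℕ) : ℝ) ^ β * Xint σ N (Φ N) φ t z - B}) atTop (𝓝 0) := by
  sorry

/-! ## Composition (proved): the five stubs give the crux -/

/-- The Knudsen-margin arithmetic: `0 < κ`, `κ y² ≤ A + B y` ⇒ `y² ≤ 2A/κ + (B/κ)²`. -/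
theorem knudsen_margin {κ A B y : ℝ} (hκ : 0 < κ) (h : κ * y ^ 2 ≤ A + B * y) :
    y ^ 2 ≤ 2 * A / κ + (B / κ) ^ 2 := by
  -- `B y ≤ B²/(2κ) + κ y²/2` from `(B − κ y)² ≥ 0`, hence `κ y²/2 ≤ A + B²/(2κ)`
  have h2 : 0 ≤ (B - κ * y) ^ 2 := sq_nonneg _
  have h3 : 2 * κ * (B * y) ≤ B ^ 2 + κ ^ 2 * y ^ 2 := by nlinarith [h2]
  have h4 : κ * (κ * y ^ 2) ≤ 2 * κ * A + B ^ 2 := by nlinarith [h, h3, hκ]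
  have h5 : y ^ 2 ≤ (2 * κ * A + B ^ 2) / κ ^ 2 := by
    rw [le_div_iff₀ (by positivity)]
    nlinarith [h4, hκ]
  calc y ^ 2 ≤ (2 * κ * A + B ^ 2) / κ ^ 2 := h5
    _ = 2 * A / κ + (B / κ) ^ 2 := by
      field_simp

/-- The local Gibbs law does not charge the complement of the good set of the flow. -/
theorem localGibbsLaw_compl_good (σ : ℝ) (a₀ θ₀ : T3 → ℝ) (u₀ : T3 → V3) (N : ℕ) (Φ : Flow σ N) :
    localGibbsLaw σ a₀ u₀ θ₀ N Φ Φ.goodᶜ = 0 :=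
  localGibbsLaw_absolutelyContinuous σ a₀ u₀ θ₀ N Φ Φ.measure_compl_good

/-- DETERMINISTIC CORE of the composition: if `κ > 0`, `P ≤ a + b √X`, `κ X − B ≤ P` and `0 ≤ b`, then
`X ≤ 2 (a + B) / κ + (b / κ)²`. -/
theorem xint_le_of_budget_of_coercive {κ a b B P X : ℝ} (hκ : 0 < κ) (hX : 0 ≤ X)
    (hbud : P ≤ a + b * Real.sqrt X) (hcoe : κ * X - B ≤ P) :
    X ≤ 2 * (a + B) / κ + (b / κ) ^ 2 := by
  have hy : κ * Real.sqrt X ^ 2 ≤ (a + B) + b * Real.sqrt X := by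
    rw [Real.sq_sqrt hX]
    linarith
  have := knudsen_margin hκ hy
  rwa [Real.sq_sqrt hX] at this


/-- Negative powers of `N + 1` tend to zero. -/
theorem tendsto_natSucc_rpow_neg {e : ℝ} (he : e < 0) :
    Tendsto (fun N : ℕ => ((N + 1 : ℕ) : ℝ) ^ e) atTop (𝓝 0) := by
  have hcast : Tendsto (fun N : ℕ => ((N + 1 : ℕ) : ℝ)) atTop atTop :=
    tendsto_natCast_atTop_atTop.comp (tendsto_add_atTop_nat 1)
  have h := (tendsto_rpow_neg_atTop (by linarith : 0 < -e)).comp hcast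
  simpa [Function.comp_def, neg_neg] using h

/-- The vanishing sequence of the composition. -/
def cseq (γ β η B K : ℝ) (N : ℕ) : ℝ :=
  2 * (((N + 1 : ℕ) : ℝ) ^ γ + B) / (η * ((N + 1 : ℕ) : ℝ) ^ β) +
    (K * ((N + 1 : ℕ) : ℝ) ^ γ * ((N + 1 : ℕ) : ℝ) ^ ((β - γ) / 2) / (η * ((N + 1 : ℕ) : ℝ) ^ β)) ^ 2

/-- `cseq → 0` for `0 < γ < β`, `0 < η`. -/
theorem tendsto_cseq {γ β η B K : ℝ} (hγ : 0 < γ) (hγβ : γ < β) (hη : 0 < η) :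
    Tendsto (cseq γ β η B K) atTop (𝓝 0) := by
  have hpos : ∀ N : ℕ, (0 : ℝ) < ((N + 1 : ℕ) : ℝ) := fun N => by exact_mod_cast Nat.succ_pos N
  have e1 : ∀ N : ℕ, cseq γ β η B K N =
      (2 / η) * ((N + 1 : ℕ) : ℝ) ^ (γ - β) + (2 * B / η) * ((N + 1 : ℕ) : ℝ) ^ (-β) +
        (K / η) ^ 2 * ((N + 1 : ℕ) : ℝ) ^ (-(β - γ)) := by
    intro N
    have hN := hpos N
    have hβ : ((N + 1 : ℕ) : ℝ) ^ β ≠ 0 := (Real.rpow_pos_of_pos hN β).ne'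
    unfold cseq
    have t1 : ((N + 1 : ℕ) : ℝ) ^ (γ - β) = ((N + 1 : ℕ) : ℝ) ^ γ / ((N + 1 : ℕ) : ℝ) ^ β :=
      Real.rpow_sub hN γ β
    have t2 : ((N + 1 : ℕ) : ℝ) ^ (-β) = (((N + 1 : ℕ) : ℝ) ^ β)⁻¹ := Real.rpow_neg hN.le β
    have t3 : ((N + 1 : ℕ) : ℝ) ^ (-(β - γ)) =
        (((N + 1 : ℕ) : ℝ) ^ γ * ((N + 1 : ℕ) : ℝ) ^ ((β - γ) / 2) / ((N + 1 : ℕ) : ℝ) ^ β) ^ 2 := by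
      rw [div_pow, mul_pow, ← Real.rpow_natCast, ← Real.rpow_natCast, ← Real.rpow_natCast,
        ← Real.rpow_mul hN.le, ← Real.rpow_mul hN.le, ← Real.rpow_mul hN.le, ← Real.rpow_add hN,
        ← Real.rpow_sub hN]
      congr 1
      push_cast
      ring
    rw [t1, t2, t3]
    field_simp
  rw [show cseq γ β η B K = _ from funext e1]
  have h1 := (tendsto_natSucc_rpow_neg (by linarith : γ - β < 0)).const_mul (2 / η)
  have h2 := (tendsto_natSucc_rpow_neg (by linarith : -β < 0)).const_mul (2 * B / η)
  have h3 := (tendsto_natSucc_rpow_neg (by linarith : -(β - γ) < 0)).const_mul ((K / η) ^ 2)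
  simpa using (h1.add h2).add h3

/-- PROBABILISTIC CORE of the composition: the pathwise budget (for `N ≥ N₀` on good orbits), the time-zero
and tail estimates, and coercivity at a power rate `β > γ` give `P_N{δ < X} → 0` for every `δ > 0`. -/
theorem tendsto_conclusion {a₀ θ₀ : T3 → ℝ} {u₀ : T3 → V3} {σ : ℝ} {Φ : Flows σ} {γ : ℝ}
    {φ : ℕ → T3 → ℝ} {t : ℝ} {K : ℝ} {N₀ : ℕ}
    (hbud : ∀ N : ℕ, N₀ ≤ N → ∀ z ∈ (Φ N).good,
        prodColl σ N (Φ N) φ t z ≤ anisC N φ ((Φ N).flow 0 z) +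
          K * ((N + 1 : ℕ) : ℝ) ^ γ * Real.sqrt (vmaxInt σ N (Φ N) t z) * Real.sqrt (Xint σ N (Φ N) φ t z))
    (hZ : ∀ p : ℝ, 0 < p → Tendsto (fun N : ℕ => localGibbsLaw σ a₀ u₀ θ₀ N (Φ N)
        {z | ((N + 1 : ℕ) : ℝ) ^ p < anisC N φ ((Φ N).flow 0 z)}) atTop (𝓝 0))
    (hH : ∀ p : ℝ, 0 < p → Tendsto (fun N : ℕ => localGibbsLaw σ a₀ u₀ θ₀ N (Φ N)
        {z | ((N + 1 : ℕ) : ℝ) ^ p < vmaxInt σ N (Φ N) t z}) atTop (𝓝 0))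
    {β η B : ℝ} (hγ : 0 < γ) (hγβ : γ < β) (hη : 0 < η)
    (hcoe : Tendsto (fun N : ℕ => localGibbsLaw σ a₀ u₀ θ₀ N (Φ N)
        {z | prodColl σ N (Φ N) φ t z < η * ((N + 1 : ℕ) : ℝ) ^ β * Xint σ N (Φ N) φ t z - B})
        atTop (𝓝 0))
    {δ : ℝ} (hδ : 0 < δ) :
    Tendsto (fun N : ℕ => localGibbsLaw σ a₀ u₀ θ₀ N (Φ N) {z | δ < Xint σ N (Φ N) φ t z})
      atTop (𝓝 0) := by
  set p : ℝ := β - γ with hp_def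
  have hp : 0 < p := by simp only [hp_def]; linarith
  set K' : ℝ := max K 0 with hK'_def
  have hK' : 0 ≤ K' := le_max_right _ _
  have hpos : ∀ N : ℕ, (0 : ℝ) < ((N + 1 : ℕ) : ℝ) := fun N => by exact_mod_cast Nat.succ_pos N
  -- the bad events
  let EZ : (N : ℕ) → Set (Cfg N) := fun N => {z | ((N + 1 : ℕ) : ℝ) ^ γ < anisC N φ ((Φ N).flow 0 z)}
  let EH : (N : ℕ) → Set (Cfg N) := fun N => {z | ((N + 1 : ℕ) : ℝ) ^ p < vmaxInt σ N (Φ N) t z}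
  let EB : (N : ℕ) → Set (Cfg N) := fun N =>
    {z | prodColl σ N (Φ N) φ t z < η * ((N + 1 : ℕ) : ℝ) ^ β * Xint σ N (Φ N) φ t z - B}
  -- deterministic inclusion, eventually in `N`
  have hc : ∀ᶠ N : ℕ in atTop, cseq γ β η B K' N < δ :=
    (tendsto_cseq hγ hγβ hη).eventually (gt_mem_nhds hδ)
  have hN₀ : ∀ᶠ N : ℕ in atTop, N₀ ≤ N := eventually_ge_atTop N₀
  have hincl : ∀ᶠ N : ℕ in atTop,
      {z | δ < Xint σ N (Φ N) φ t z} ⊆ EZ N ∪ EH N ∪ EB N ∪ (Φ N).goodᶜ := by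
    filter_upwards [hc, hN₀] with N hcN hNN z hz
    simp only [mem_setOf_eq] at hz
    by_contra hnot
    simp only [mem_union, mem_compl_iff, mem_setOf_eq, not_or, not_lt, not_not, EZ, EH, EB] at hnot
    obtain ⟨⟨⟨hz0, hzH⟩, hzB⟩, hzg⟩ := hnot
    have hX : 0 ≤ Xint σ N (Φ N) φ t z := by
      unfold Xint
      exact integral_nonneg fun s => integral_nonneg fun x => by
        rw [defectSq_eq_defectC]; unfold defectC; positivity
    -- budget with `K'` and the thresholds inserted
    have hb1 := hbud N hNN z hzg
    have hsq : Real.sqrt (vmaxInt σ N (Φ N) t z) ≤ ((N + 1 : ℕ) : ℝ) ^ (p / 2) := by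
      calc Real.sqrt (vmaxInt σ N (Φ N) t z) ≤ Real.sqrt (((N + 1 : ℕ) : ℝ) ^ p) :=
            Real.sqrt_le_sqrt hzH
        _ = ((N + 1 : ℕ) : ℝ) ^ (p / 2) := by
            rw [Real.sqrt_eq_rpow, ← Real.rpow_mul (hpos N).le]
            congr 1
            ring
    have hb2 : prodColl σ N (Φ N) φ t z ≤ ((N + 1 : ℕ) : ℝ) ^ γ +
        (K' * ((N + 1 : ℕ) : ℝ) ^ γ * ((N + 1 : ℕ) : ℝ) ^ (p / 2)) * Real.sqrt (Xint σ N (Φ N) φ t z) := by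
      have hKK : K * ((N + 1 : ℕ) : ℝ) ^ γ * Real.sqrt (vmaxInt σ N (Φ N) t z) *
          Real.sqrt (Xint σ N (Φ N) φ t z) ≤
          K' * ((N + 1 : ℕ) : ℝ) ^ γ * ((N + 1 : ℕ) : ℝ) ^ (p / 2) * Real.sqrt (Xint σ N (Φ N) φ t z) := by
        have hγN : 0 ≤ ((N + 1 : ℕ) : ℝ) ^ γ := (Real.rpow_pos_of_pos (hpos N) γ).le
        have hs : 0 ≤ Real.sqrt (vmaxInt σ N (Φ N) t z) := Real.sqrt_nonneg _
        have hsX : 0 ≤ Real.sqrt (Xint σ N (Φ N) φ t z) := Real.sqrt_nonneg _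
        calc K * ((N + 1 : ℕ) : ℝ) ^ γ * Real.sqrt (vmaxInt σ N (Φ N) t z) *
              Real.sqrt (Xint σ N (Φ N) φ t z)
            ≤ K' * ((N + 1 : ℕ) : ℝ) ^ γ * Real.sqrt (vmaxInt σ N (Φ N) t z) *
              Real.sqrt (Xint σ N (Φ N) φ t z) := by
              have hrest : 0 ≤ ((N + 1 : ℕ) : ℝ) ^ γ * Real.sqrt (vmaxInt σ N (Φ N) t z) *
                  Real.sqrt (Xint σ N (Φ N) φ t z) := mul_nonneg (mul_nonneg hγN hs) hsX
              have hKle : K ≤ K' := le_max_left _ _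
              nlinarith [hrest, hKle]
          _ ≤ K' * ((N + 1 : ℕ) : ℝ) ^ γ * ((N + 1 : ℕ) : ℝ) ^ (p / 2) *
              Real.sqrt (Xint σ N (Φ N) φ t z) := by
              gcongr
      linarith
    have hκ : 0 < η * ((N + 1 : ℕ) : ℝ) ^ β := mul_pos hη (Real.rpow_pos_of_pos (hpos N) β)
    have hcoe' : η * ((N + 1 : ℕ) : ℝ) ^ β * Xint σ N (Φ N) φ t z - B ≤ prodColl σ N (Φ N) φ t z := hzB
    have hmain := xint_le_of_budget_of_coercive (B := B) hκ hX hb2 hcoe' 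
    have : Xint σ N (Φ N) φ t z ≤ cseq γ β η B K' N := by
      unfold cseq
      simpa [hp_def] using hmain
    linarith
  -- measure bound, eventually in `N`
  have hle : ∀ᶠ N : ℕ in atTop, localGibbsLaw σ a₀ u₀ θ₀ N (Φ N) {z | δ < Xint σ N (Φ N) φ t z} ≤
      localGibbsLaw σ a₀ u₀ θ₀ N (Φ N) (EZ N) + localGibbsLaw σ a₀ u₀ θ₀ N (Φ N) (EH N) +
        localGibbsLaw σ a₀ u₀ θ₀ N (Φ N) (EB N) := by
    filter_upwards [hincl] with N hN
    calc localGibbsLaw σ a₀ u₀ θ₀ N (Φ N) {z | δ < Xint σ N (Φ N) φ t z}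
        ≤ localGibbsLaw σ a₀ u₀ θ₀ N (Φ N) (EZ N ∪ EH N ∪ EB N ∪ (Φ N).goodᶜ) := measure_mono hN
      _ ≤ localGibbsLaw σ a₀ u₀ θ₀ N (Φ N) (EZ N ∪ EH N ∪ EB N) +
            localGibbsLaw σ a₀ u₀ θ₀ N (Φ N) (Φ N).goodᶜ := measure_union_le _ _
      _ = localGibbsLaw σ a₀ u₀ θ₀ N (Φ N) (EZ N ∪ EH N ∪ EB N) := by
            rw [localGibbsLaw_compl_good, add_zero]
      _ ≤ localGibbsLaw σ a₀ u₀ θ₀ N (Φ N) (EZ N ∪ EH N) + localGibbsLaw σ a₀ u₀ θ₀ N (Φ N) (EB N) :=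
            measure_union_le _ _
      _ ≤ _ := by
            gcongr
            exact measure_union_le _ _
  have hsum : Tendsto (fun N : ℕ => localGibbsLaw σ a₀ u₀ θ₀ N (Φ N) (EZ N) +
      localGibbsLaw σ a₀ u₀ θ₀ N (Φ N) (EH N) + localGibbsLaw σ a₀ u₀ θ₀ N (Φ N) (EB N)) atTop (𝓝 0) := by
    have := ((hZ γ hγ).add (hH p hp)).add hcoe
    rw [add_zero, add_zero] at this
    exact this
  exact tendsto_of_tendsto_of_tendsto_of_le_of_le' tendsto_const_nhds hsum
    (Eventually.of_forall fun N => bot_le) hle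

/-- **THE COMPOSITION.** The five stubs give the crux `CollisionIsometryCLT.AdaptedWeightCLT` (rev-12,
time-local form) by name: `adaptedWeightCLT_iff` (`Iff.rfl`), `σ₀ := min σ₀(coercivity) 2⁻¹`, per horizon
`cruxTailT_of_conclOn`, `conclOn_of_tendsto_defect` (the crux's event IS `{δ < X}`), and `tendsto_conclusion`. -/
theorem AdaptedWeightCLT_of (h1 : PointwiseStub) (h1' : LipschitzStub) (h1'' : FreeStretchStub)
    (h2 : PathwiseBudgetStub) (h3 : TimeZeroStub) (h4 : TailsVmaxStub) (h5 : CoercivityStub) :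
    Summit.AtomisticToContinuum.HydrodynamicLimit.Theses.CollisionIsometryCLT.AdaptedWeightCLT := by
  rw [adaptedWeightCLT_iff]
  intro a₀ θ₀ u₀ ha hθ hu ha0 hθ0
  have hnice : NiceProfiles a₀ θ₀ u₀ := ⟨ha, hθ, hu, ha0, hθ0⟩
  obtain ⟨σ₀, hσ₀, H5⟩ := h5 a₀ θ₀ u₀ hnice
  refine ⟨min σ₀ 2⁻¹, lt_min hσ₀ (by norm_num), fun σ hσ hσlt Φ hDiff => ?_⟩
  have hσ₀' : σ < σ₀ := lt_of_lt_of_le hσlt (min_le_left _ _)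
  have hσ2 : σ < 2⁻¹ := lt_of_lt_of_le hσlt (min_le_right _ _)
  refine cruxTailT_of_conclOn fun t ht hT => ?_
  refine SourceContraction.conclOn_of_tendsto_defect fun γ C φ hγ hγ' hadm δ hδ => ?_
  obtain ⟨β, η, B, hγβ, hη, hcoe⟩ := H5 σ hσ hσ₀' Φ hDiff γ C φ hγ hγ' hadm t ht hT
  have hP := h1 γ C φ hγ hγ' hadm
  have hL := h1' γ C φ hγ hγ' hadm σ hσ hσ2 hP
  have hF := h1'' γ C φ hγ hγ' hadm σ hσ hσ2 hL
  obtain ⟨K, N₀, hbud⟩ := h2 γ C φ hγ hγ' hadm σ hσ hσ2 hF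
  exact tendsto_conclusion (fun N hN z hz => hbud N hN (Φ N) t ht.le z hz)
    (fun p hp => h3 a₀ θ₀ u₀ hnice σ hσ hσ2 γ C φ hγ hγ' hadm Φ p hp)
    (fun p hp => h4 a₀ θ₀ u₀ hnice σ hσ hσ2 Φ t ht hT p hp) hγ hγβ hη hcoe hδ

/-- The crux from the five stubs as stated (sorries only in `stub_*`). -/
theorem AdaptedWeightCLT_of_stubs :
    Summit.AtomisticToContinuum.HydrodynamicLimit.Theses.CollisionIsometryCLT.AdaptedWeightCLT :=
  AdaptedWeightCLT_of stub_pointwise stub_lipschitz stub_freeStretch stub_pathwiseBudget stub_timeZero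
    stub_tailsVmax stub_coercivity

end

end Summit.AtomisticToContinuum.HydrodynamicLimit.Theorems.ContactBalance
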